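import Literature.MeasureTheory.OptimalTransport.KantorovichRubinstein
import Literature.Analysis.FunctionSpaces.KantorovichLogDistance
import Literature.Analysis.FunctionSpaces.TorusRademacher
import Mathlib.Analysis.Calculus.LocalExtr.Basic
import HarnessLib

/-!
# The logarithmic Kantorovich–Rubinstein distance on `T^d`: primal side and optimal potentials

Analysis/FunctionSpaces support file (everything proved), companion of `KantorovichLogDistance`
(which defines `Torus.krLogDist δ θ = sup {∫ θ ζ : ζ log-Lipschitz}` in dual form). Using the
tree's Kantorovich(–Rubinstein) duality on compact metric spaces
(`Literature.MeasureTheory.OptimalTransport.exists_isCoupling_isKRPotential`) we supply what the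
printed proof of Seis 2022, Lemma 3 (= Otto–Seis–Slepčev 2013 / Seis 2018, the rate of change of
`D_δ` along advection–diffusion) uses on the *primal* side:

* `Torus.exists_isCoupling_isLogLipschitz` — for mean-zero `θ ∈ L¹(T^d)` and `δ > 0` there are
  an optimal plan `π ∈ Π(θ⁺ dx, θ⁻ dx)` and an optimal log-Lipschitz potential `ζ` with
  `∫∫ c_δ dπ = ∫ θ ζ = krLogDist δ θ` and `ζ x - ζ y = c_δ(x, y)` for `π`-a.e. `(x, y)`
  (so the dual definition of the tree *is* Seis' `D_δ(θ) = inf_π ∫∫ log(|x-y|/δ+1) dπ`);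
* **first-order structure on the contact set** (the Eulerian substitute for the Lagrangian
  computation `d/dt c_δ(X_t x, X_t y)` of Seis 2017/2018): log-Lipschitz functions are
  differentiable a.e. (Rademacher, through the periodic lift), and at a contact pair
  `ζ x - ζ y = c_δ(x, y)` of points of differentiability,
  `∇ζ(x) = ∇ζ(y)` (translation invariance of the cost) and `‖∇ζ(x)‖ ≤ (δ + dist x y)⁻¹`
  (concavity of `log(1 + ·/δ)`), packaged `π`-a.e. in `Torus.exists_isCoupling_gradient`.

## References

* C. Seis, *Bounds on the rate of enhanced dissipation*, Comm. Math. Phys. 399 (2023)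
  (arXiv:2003.08794), §2.2, Lemma 3 and its sources [OttoSeisSlepcev13, Seis18]. [`Seis2022`]
* C. Villani, *Topics in Optimal Transportation* (AMS 2003), Thm. 1.3, Thm. 1.14. [`Villani2003`]
-/

noncomputable section

open MeasureTheory Set Filter Metric Topology
open scoped ENNReal InnerProductSpace

namespace Literature.Analysis.FunctionSpaces

namespace Torus

open Literature.MeasureTheory.OptimalTransport

variable {d : Type*} [Fintype d]

/-! ## The logarithmic cost as a continuous metric cost -/

/-- The logarithmic cost `c_δ` as a continuous function on `T^d × T^d` (`δ > 0`).
[cite: Seis2022, §2.2 (p. 6)] -/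
def logCostMap {δ : ℝ} (hδ : 0 < δ) : C(UnitAddTorus d × UnitAddTorus d, ℝ) where
  toFun z := logCost δ z.1 z.2
  continuous_toFun := by
    have hc : Continuous fun z : UnitAddTorus d × UnitAddTorus d => 1 + dist z.1 z.2 / δ := by
      fun_prop
    have : (fun z : UnitAddTorus d × UnitAddTorus d => logCost δ z.1 z.2) =
        fun z => Real.log (1 + dist z.1 z.2 / δ) := by
      funext z; rw [logCost_def]
    rw [this]
    exact Real.continuousOn_log.comp_continuous hc fun z =>
      (by positivity : (0 : ℝ) < 1 + dist z.1 z.2 / δ).ne'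

/-- Unfolding `logCostMap`. [folklore] -/
@[simp]
theorem logCostMap_apply {δ : ℝ} (hδ : 0 < δ) (z : UnitAddTorus d × UnitAddTorus d) :
    logCostMap hδ z = logCost δ z.1 z.2 :=
  rfl

/-- `c_δ` is a continuous metric cost. [folklore] -/
theorem isMetricCost_logCostMap {δ : ℝ} (hδ : 0 < δ) : IsMetricCost (logCostMap (d := d) hδ) where
  self x := logCost_self δ x
  symm x y := logCost_comm δ x y
  triangle x y z := logCost_triangle hδ x y z

/-- KR potentials for `c_δ` are exactly the log-Lipschitz functions. [folklore] -/
theorem isKRPotential_logCostMap_iff {δ : ℝ} (hδ : 0 < δ) {ζ : UnitAddTorus d → ℝ} :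
    IsKRPotential (logCostMap (d := d) hδ) ζ ↔ IsLogLipschitz δ ζ := by
  simp only [IsKRPotential, IsLogLipschitz, logCostMap_apply]

/-! ## The measures `θ⁺ dx`, `θ⁻ dx` -/

/-- The measure `θ⁺ dx` on `T^d`. [folklore] -/
def posMeasure (θ : UnitAddTorus d → ℝ) : Measure (UnitAddTorus d) :=
  volume.withDensity fun x => ENNReal.ofReal (θ x)

/-- The measure `θ⁻ dx` on `T^d`. [folklore] -/
def negMeasure (θ : UnitAddTorus d → ℝ) : Measure (UnitAddTorus d) :=
  volume.withDensity fun x => ENNReal.ofReal (-θ x)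

/-- `θ⁻ dx = (-θ)⁺ dx`. [folklore] -/
theorem negMeasure_eq_posMeasure_neg (θ : UnitAddTorus d → ℝ) :
    negMeasure θ = posMeasure (-θ) :=
  rfl

/-- `θ⁺ dx` is finite for integrable `θ`. [folklore] -/
theorem isFiniteMeasure_posMeasure {θ : UnitAddTorus d → ℝ} (hθ : Integrable θ volume) :
    IsFiniteMeasure (posMeasure θ) :=
  isFiniteMeasure_withDensity_ofReal hθ.2

/-- `θ⁻ dx` is finite for integrable `θ`. [folklore] -/
theorem isFiniteMeasure_negMeasure {θ : UnitAddTorus d → ℝ} (hθ : Integrable θ volume) :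
    IsFiniteMeasure (negMeasure θ) :=
  isFiniteMeasure_withDensity_ofReal hθ.neg.2

/-- `θ⁺ dx ≪ dx`. [folklore] -/
theorem posMeasure_absolutelyContinuous (θ : UnitAddTorus d → ℝ) :
    posMeasure θ ≪ volume :=
  withDensity_absolutelyContinuous _ _

/-- `θ⁻ dx ≪ dx`. [folklore] -/
theorem negMeasure_absolutelyContinuous (θ : UnitAddTorus d → ℝ) :
    negMeasure θ ≪ volume :=
  withDensity_absolutelyContinuous _ _

/-- Total mass of `θ⁺ dx`: `∫ θ⁺`. [folklore] -/
theorem posMeasure_univ {θ : UnitAddTorus d → ℝ} (hθ : Integrable θ volume) :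
    posMeasure θ univ = ENNReal.ofReal (∫ x, max (θ x) 0) := by
  rw [posMeasure, withDensity_apply _ MeasurableSet.univ, Measure.restrict_univ,
    ofReal_integral_eq_lintegral_ofReal (hθ.pos_part) (Eventually.of_forall fun x => le_max_right _ _)]
  refine lintegral_congr fun x => ?_
  rcases le_total (θ x) 0 with h | h
  · simp [max_eq_right h, ENNReal.ofReal_of_nonpos h]
  · simp [max_eq_left h]

/-- Equality of the masses of `θ⁺ dx` and `θ⁻ dx` for mean-zero `θ`. [folklore] -/
theorem posMeasure_univ_eq_negMeasure_univ {θ : UnitAddTorus d → ℝ} (hθ : Integrable θ volume)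
    (h0 : ∫ x, θ x = 0) : posMeasure θ univ = negMeasure θ univ := by
  rw [negMeasure_eq_posMeasure_neg, posMeasure_univ hθ, posMeasure_univ hθ.neg]
  congr 1
  have h1 := integral_sub hθ.pos_part hθ.neg.pos_part
  have h2 : ∫ x, (max (θ x) 0 - max ((-θ) x) 0) = ∫ x, θ x := by
    refine integral_congr_ae (Eventually.of_forall fun x => ?_)
    simp only [Pi.neg_apply]
    rcases le_total (θ x) 0 with h | h
    · rw [max_eq_right h, max_eq_left (neg_nonneg.2 h)]; ring
    · rw [max_eq_left h, max_eq_right (neg_nonpos.2 h)]; ring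
  simp only [Pi.neg_apply] at h1 h2 ⊢
  linarith

/-- Integration against `θ⁺ dx`: `∫ g d(θ⁺dx) = ∫ θ⁺ g`. [folklore] -/
theorem integral_posMeasure {θ : UnitAddTorus d → ℝ} (hθ : AEStronglyMeasurable θ volume)
    {E : Type*} [NormedAddCommGroup E] [NormedSpace ℝ E] (g : UnitAddTorus d → E) :
    ∫ x, g x ∂(posMeasure θ) = ∫ x, (max (θ x) 0) • g x := by
  rw [posMeasure, integral_withDensity_eq_integral_toReal_smul₀ hθ.aemeasurable.ennreal_ofReal
    (Eventually.of_forall fun x => ENNReal.ofReal_lt_top)]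
  refine integral_congr_ae (Eventually.of_forall fun x => ?_)
  simp only [ENNReal.toReal_ofReal']

/-- Integration against `θ⁻ dx`: `∫ g d(θ⁻dx) = ∫ θ⁻ g`. [folklore] -/
theorem integral_negMeasure {θ : UnitAddTorus d → ℝ} (hθ : AEStronglyMeasurable θ volume)
    {E : Type*} [NormedAddCommGroup E] [NormedSpace ℝ E] (g : UnitAddTorus d → E) :
    ∫ x, g x ∂(negMeasure θ) = ∫ x, (max (-θ x) 0) • g x := by
  rw [negMeasure_eq_posMeasure_neg, integral_posMeasure hθ.neg]
  rfl

/-- `∫ g d(θ⁺dx) - ∫ g d(θ⁻dx) = ∫ θ g` for bounded measurable... here: for `g` with `θ g`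
integrable and `g` a.e. strongly measurable and essentially bounded through `|θ| |g|`
integrable. Stated for `g` such that `x ↦ |θ x| * ‖g x‖` is integrable. [folklore] -/
theorem integral_posMeasure_sub_integral_negMeasure {θ : UnitAddTorus d → ℝ}
    (hθ : AEStronglyMeasurable θ volume) {g : UnitAddTorus d → ℝ}
    (hpos : Integrable (fun x => max (θ x) 0 * g x) volume)
    (hneg : Integrable (fun x => max (-θ x) 0 * g x) volume) :
    ∫ x, g x ∂(posMeasure θ) - ∫ x, g x ∂(negMeasure θ) = ∫ x, θ x * g x := by
  rw [integral_posMeasure hθ, integral_negMeasure hθ]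
  simp only [smul_eq_mul]
  rw [← integral_sub hpos hneg]
  refine integral_congr_ae (Eventually.of_forall fun x => ?_)
  dsimp only
  rcases le_total (θ x) 0 with h | h
  · rw [max_eq_right h, max_eq_left (neg_nonneg.2 h)]; ring
  · rw [max_eq_left h, max_eq_right (neg_nonpos.2 h)]; ring

/-- Integrability of `θ^± g` for integrable `θ` and bounded a.e.-strongly measurable `g`. [folklore] -/
theorem integrable_max_mul {θ g : UnitAddTorus d → ℝ} (hθ : Integrable θ volume)
    (hg : AEStronglyMeasurable g volume) {C : ℝ} (hC : ∀ x, |g x| ≤ C) :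
    Integrable (fun x => max (θ x) 0 * g x) volume := by
  refine Integrable.mono' (hθ.norm.mul_const C) (hθ.pos_part.aestronglyMeasurable.mul hg)
    (Eventually.of_forall fun x => ?_)
  rw [Real.norm_eq_abs, abs_mul, Real.norm_eq_abs]
  refine mul_le_mul ?_ (hC x) (abs_nonneg _) (abs_nonneg _)
  rw [abs_of_nonneg (le_max_right _ _)]
  exact max_le (le_abs_self _) (abs_nonneg _)

/-! ## Optimal plan and optimal potential -/

/-- **Kantorovich–Rubinstein duality for `D_δ` on `T^d`** (Villani 2003, Thm. 1.3/1.14 applied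
to the metric cost `c_δ`; Seis 2022, §2.2): for `δ > 0` and mean-zero `θ ∈ L¹(T^d)` there are a
coupling `π` of `θ⁺ dx` and `θ⁻ dx` and a log-Lipschitz potential `ζ` such that
`∫∫ c_δ dπ = krLogDist δ θ = ∫ θ ζ` and `ζ x - ζ y = c_δ(x, y)` for `π`-a.e. `(x, y)`.
In particular the dual-form `krLogDist` of the tree coincides with Seis'
`D_δ(θ) = inf_{π ∈ Π(θ⁺,θ⁻)} ∫∫ log(|x - y|/δ + 1) dπ` and the infimum is a minimum.
[cite: Seis2022, §2.2 (p. 6)] -/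
theorem exists_isCoupling_isLogLipschitz {δ : ℝ} (hδ : 0 < δ) {θ : UnitAddTorus d → ℝ}
    (hθ : Integrable θ volume) (h0 : ∫ x, θ x = 0) :
    ∃ (π : Measure (UnitAddTorus d × UnitAddTorus d)) (ζ : UnitAddTorus d → ℝ),
      IsCoupling (posMeasure θ) (negMeasure θ) π ∧ IsLogLipschitz δ ζ ∧
      ∫ z, logCost δ z.1 z.2 ∂π = krLogDist δ θ ∧ ∫ x, θ x * ζ x = krLogDist δ θ ∧
      (∀ π' : Measure (UnitAddTorus d × UnitAddTorus d), IsCoupling (posMeasure θ) (negMeasure θ) π' →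
        krLogDist δ θ ≤ ∫ z, logCost δ z.1 z.2 ∂π') ∧
      ∀ᵐ z ∂π, ζ z.1 - ζ z.2 = logCost δ z.1 z.2 := by
  haveI := isFiniteMeasure_posMeasure hθ
  haveI := isFiniteMeasure_negMeasure hθ
  obtain ⟨π, ζ, hπ, hζ, hcost, hmin, hmax, hslack⟩ :=
    exists_isCoupling_isKRPotential (μ := posMeasure θ) (ν := negMeasure θ)
      (isMetricCost_logCostMap (d := d) hδ) (posMeasure_univ_eq_negMeasure_univ hθ h0)
  have hζ' : IsLogLipschitz δ ζ := hζ
  -- `∫ ζ d(θ⁺) - ∫ ζ d(θ⁻) = ∫ θ ζ`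
  have hbound : ∀ x, |ζ x - ζ 0| ≤ Real.log (1 + 1 / (2 * δ)) := fun x => hζ'.abs_sub_le_log hδ x 0
  have key : ∀ (ξ : UnitAddTorus d → ℝ), IsLogLipschitz δ ξ →
      ∫ x, ξ x ∂(posMeasure θ) - ∫ x, ξ x ∂(negMeasure θ) = ∫ x, θ x * ξ x := by
    intro ξ hξ
    obtain ⟨C, hC⟩ : ∃ C, ∀ x, |ξ x| ≤ C := by
      refine ⟨|ξ 0| + Real.log (1 + 1 / (2 * δ)), fun x => ?_⟩
      have := hξ.abs_sub_le_log hδ x 0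
      have := abs_sub_abs_le_abs_sub (ξ x) (ξ 0)
      linarith
    have hξm : AEStronglyMeasurable ξ volume := (hξ.continuous hδ).aestronglyMeasurable
    exact integral_posMeasure_sub_integral_negMeasure hθ.aestronglyMeasurable
      (integrable_max_mul hθ hξm hC) (by
        have := integrable_max_mul hθ.neg hξm hC
        simpa using this)
  have hval : ∫ x, θ x * ζ x = krLogDist δ θ := by
    refine le_antisymm (integral_mul_le_krLogDist hδ hθ h0 hζ') ?_
    haveI : Nonempty {ξ : UnitAddTorus d → ℝ // IsLogLipschitz δ ξ} := nonempty_isLogLipschitz hδ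
    refine ciSup_le fun ξ => ?_
    have hξc : Continuous (ξ : UnitAddTorus d → ℝ) := ξ.2.continuous hδ
    have := hmax ⟨_, hξc⟩ ξ.2
    simp only [ContinuousMap.coe_mk] at this
    rw [key _ ξ.2, key _ hζ'] at this
    exact this
  have hcost' : ∫ z, logCost δ z.1 z.2 ∂π = ∫ x, θ x * ζ x := by
    rw [← key _ hζ']
    exact hcost
  refine ⟨π, ζ, hπ, hζ', hcost'.trans hval, hval, fun π' hπ' => ?_, ?_⟩
  · rw [← hval, ← hcost']
    exact hmin π' hπ'
  · simpa using hslack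

/-! ## Rademacher and the first-order structure of log-Lipschitz potentials -/

/-- **Rademacher on the torus** for log-Lipschitz functions: differentiable (through the
re-centred lift) at a.e. point of `T^d` (the tree's `Torus.ae_differentiableAt_liftAt`). [folklore] -/
theorem IsLogLipschitz.ae_differentiableAt {δ : ℝ} (hδ : 0 < δ) {ζ : UnitAddTorus d → ℝ}
    (hζ : IsLogLipschitz δ ζ) :
    ∀ᵐ x ∂(volume : Measure (UnitAddTorus d)), DifferentiableAt ℝ (liftAt ζ x) 0 :=
  ae_differentiableAt_liftAt (hζ.lipschitzWith hδ)

/-- Global bound: `‖∇ζ(x)‖ ≤ δ⁻¹` for a log-Lipschitz `ζ` (junk `0` where not differentiable).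
[folklore] -/
theorem IsLogLipschitz.norm_gradient_le_inv {δ : ℝ} (hδ : 0 < δ) {ζ : UnitAddTorus d → ℝ}
    (hζ : IsLogLipschitz δ ζ) (x : UnitAddTorus d) : ‖Torus.gradient ζ x‖ ≤ δ⁻¹ := by
  have h := norm_gradient_le_of_lipschitz (hζ.lipschitzWith hδ) x
  rwa [Real.coe_toNNReal _ (inv_nonneg.2 hδ.le)] at h

/-- **Equality of gradients at a contact pair** (translation invariance of `c_δ`): if
`ζ x - ζ y = c_δ(x, y)` for a log-Lipschitz `ζ` differentiable at `x` and at `y`, then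
`∇ζ(x) = ∇ζ(y)` — the function `v ↦ ζ(y + v) - ζ(x + v) ≥ -c_δ(x + v, y + v) = -c_δ(x, y)` is
minimal at `v = 0`. This is the Eulerian form of "`∇ₓc(x,y) = -∇_yc(x,y)` on the support of an
optimal plan" in Seis 2017/2018. [folklore] -/
theorem IsLogLipschitz.gradient_eq_of_sub_eq {δ : ℝ} {ζ : UnitAddTorus d → ℝ}
    (hζ : IsLogLipschitz δ ζ) {x y : UnitAddTorus d} (hx : DifferentiableAt ℝ (liftAt ζ x) 0)
    (hy : DifferentiableAt ℝ (liftAt ζ y) 0) (hxy : ζ x - ζ y = logCost δ x y) :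
    Torus.gradient ζ x = Torus.gradient ζ y := by
  -- the function `g v = ζ(y + v) - ζ(x + v)` has a global minimum at `0`
  have hmin : IsLocalMin (fun v => liftAt ζ y v - liftAt ζ x v) (0 : EuclideanSpace ℝ d) := by
    refine Filter.Eventually.of_forall fun v => ?_
    simp only [liftAt_apply]
    have h1 := hζ (x + proj v) (y + proj v)
    rw [logCost, dist_add_right, ← logCost_def] at h1
    have : x + proj (0 : EuclideanSpace ℝ d) = x := by simp
    have : y + proj (0 : EuclideanSpace ℝ d) = y := by simp
    simp only [proj_zero, add_zero]
    linarith
  have hd := hmin.fderiv_eq_zero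
  rw [fderiv_fun_sub hy hx, sub_eq_zero] at hd
  rw [gradient_eq_toDual_symm_torusFderiv, gradient_eq_toDual_symm_torusFderiv, Torus.fderiv, Torus.fderiv, hd]

/-- From a one-sided first-order bound to an operator-norm bound: if `f` has derivative `L` at
`0` and `f v - f 0 ≤ K ‖v‖` for all `v`, then `‖L‖ ≤ K`. [folklore] -/
theorem opNorm_le_of_sub_le {E : Type*} [NormedAddCommGroup E] [NormedSpace ℝ E] {f : E → ℝ}
    {L : E →L[ℝ] ℝ} (hf : HasFDerivAt f L 0) {K : ℝ} (hK : 0 ≤ K)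
    (h : ∀ v, f v - f 0 ≤ K * ‖v‖) : ‖L‖ ≤ K := by
  have hle : ∀ v, L v ≤ K * ‖v‖ := by
    intro v
    -- `n • (f (n⁻¹ • v) - f 0) → L v`
    have hlim := hf.lim v (l := atTop) (c := fun n : ℕ => (n : ℝ))
      (by simpa [Real.norm_natCast] using tendsto_natCast_atTop_atTop)
    simp only [zero_add] at hlim
    refine le_of_tendsto hlim ?_
    filter_upwards [eventually_gt_atTop 0] with n hn
    have hn' : (0 : ℝ) < n := by exact_mod_cast hn
    have := h ((n : ℝ)⁻¹ • v)
    rw [norm_smul, norm_inv, Real.norm_natCast] at this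
    calc (n : ℝ) • (f ((n : ℝ)⁻¹ • v) - f 0) ≤ (n : ℝ) * (K * ((n : ℝ)⁻¹ * ‖v‖)) := by
          rw [smul_eq_mul]; exact mul_le_mul_of_nonneg_left this hn'.le
      _ = K * ‖v‖ := by field_simp
  refine ContinuousLinearMap.opNorm_le_bound _ hK fun v => ?_
  rw [Real.norm_eq_abs, abs_le]
  constructor
  · have := hle (-v)
    rw [map_neg, norm_neg] at this
    linarith
  · exact hle v

/-- **Gradient bound at a contact pair** (concavity of the cost profile): if
`ζ x - ζ y = c_δ(x, y)` for a log-Lipschitz `ζ`, then `‖∇ζ(x)‖ ≤ (δ + dist x y)⁻¹`, since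
`ζ(x + v) - ζ(x) ≤ c_δ(x + v, y) - c_δ(x, y) ≤ ‖v‖ / (δ + dist x y)`. [folklore] -/
theorem IsLogLipschitz.norm_gradient_le_of_sub_eq {δ : ℝ} (hδ : 0 < δ) {ζ : UnitAddTorus d → ℝ}
    (hζ : IsLogLipschitz δ ζ) {x y : UnitAddTorus d} (hxy : ζ x - ζ y = logCost δ x y) :
    ‖Torus.gradient ζ x‖ ≤ (δ + dist x y)⁻¹ := by
  have hK : 0 ≤ (δ + dist x y)⁻¹ := by positivity
  by_cases hx : DifferentiableAt ℝ (liftAt ζ x) 0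
  · rw [gradient_eq_toDual_symm_torusFderiv, LinearIsometryEquiv.norm_map, Torus.fderiv]
    refine opNorm_le_of_sub_le hx.hasFDerivAt hK fun v => ?_
    simp only [liftAt_apply, proj_zero, add_zero]
    have h1 := hζ (x + proj v) y
    have hdist : dist (x + proj v) y ≤ dist x y + ‖v‖ := by
      calc dist (x + proj v) y ≤ dist (x + proj v) x + dist x y := dist_triangle _ _ _
        _ = ‖proj v‖ + dist x y := by rw [dist_eq_norm, add_sub_cancel_left]
        _ ≤ ‖v‖ + dist x y := by gcongr; exact norm_proj_le v
        _ = dist x y + ‖v‖ := add_comm _ _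
    have h2 := logCost_le_logCost_add_div hδ (norm_nonneg v) hdist
    rw [div_eq_mul_inv, mul_comm] at h2
    linarith
  · rw [gradient_eq_toDual_symm_torusFderiv, LinearIsometryEquiv.norm_map, Torus.fderiv,
      fderiv_zero_of_not_differentiableAt hx, norm_zero]
    exact hK

/-- **Optimal plan, optimal potential and its first-order structure, `π`-a.e.** For `δ > 0`
and mean-zero `θ ∈ L¹(T^d)`: a coupling `π ∈ Π(θ⁺dx, θ⁻dx)` and a log-Lipschitz `ζ` with
`∫ θ ζ = krLogDist δ θ = ∫∫ c_δ dπ`, and for `π`-a.e. `(x, y)`: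
`ζ x - ζ y = c_δ(x,y)`, `∇ζ(x) = ∇ζ(y)` and `‖∇ζ(x)‖ ≤ (δ + dist x y)⁻¹`
(Seis 2022, Lemma 3 via [Seis17, Seis18]: the ingredients `|∇c_δ| ≤ 1/(δ + |x - y|)` and
`∇ₓ c_δ = -∇_y c_δ` on the support of the optimal plan). [cite: Seis2022, Lemma 3 (p. 7)] -/
theorem exists_isCoupling_gradient {δ : ℝ} (hδ : 0 < δ) {θ : UnitAddTorus d → ℝ}
    (hθ : Integrable θ volume) (h0 : ∫ x, θ x = 0) :
    ∃ (π : Measure (UnitAddTorus d × UnitAddTorus d)) (ζ : UnitAddTorus d → ℝ),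
      IsCoupling (posMeasure θ) (negMeasure θ) π ∧ IsLogLipschitz δ ζ ∧
      ∫ x, θ x * ζ x = krLogDist δ θ ∧ ∫ z, logCost δ z.1 z.2 ∂π = krLogDist δ θ ∧
      ∀ᵐ z ∂π, ζ z.1 - ζ z.2 = logCost δ z.1 z.2 ∧
        Torus.gradient ζ z.1 = Torus.gradient ζ z.2 ∧
        ‖Torus.gradient ζ z.1‖ ≤ (δ + dist z.1 z.2)⁻¹ := by
  obtain ⟨π, ζ, hπ, hζ, hcost, hval, -, hslack⟩ := exists_isCoupling_isLogLipschitz hδ hθ h0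
  refine ⟨π, ζ, hπ, hζ, hval, hcost, ?_⟩
  have hD := hζ.ae_differentiableAt hδ
  have h1 : ∀ᵐ z ∂π, DifferentiableAt ℝ (liftAt ζ z.1) 0 := by
    have : ∀ᵐ x ∂(π.map Prod.fst), DifferentiableAt ℝ (liftAt ζ x) 0 := by
      rw [hπ.map_fst]; exact (posMeasure_absolutelyContinuous θ).ae_le hD
    exact ae_of_ae_map measurable_fst.aemeasurable this
  have h2 : ∀ᵐ z ∂π, DifferentiableAt ℝ (liftAt ζ z.2) 0 := by
    have : ∀ᵐ y ∂(π.map Prod.snd), DifferentiableAt ℝ (liftAt ζ y) 0 := by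
      rw [hπ.map_snd]; exact (negMeasure_absolutelyContinuous θ).ae_le hD
    exact ae_of_ae_map measurable_snd.aemeasurable this
  filter_upwards [hslack, h1, h2] with z hz hz1 hz2
  exact ⟨hz, hζ.gradient_eq_of_sub_eq hz1 hz2 hz, hζ.norm_gradient_le_of_sub_eq hδ hz⟩

end Torus

end Literature.Analysis.FunctionSpaces
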